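import Mathlib
import HarnessLib
import Literature.Analysis.FluidPDE.TypeIAncientMild
import Literature.Analysis.FluidPDE.OseenSlice
import Literature.Analysis.FluidPDE.UlocKernelEstimates
import Literature.Analysis.FluidPDE.LerayVolterraComparison
import Literature.Analysis.FluidPDE.OseenDuhamelPairCalculus
import Summits.NavierStokesRegularity.NavierStokesRegularity.Theorems.QuarterLogPincerTruncationEdgeDefs
import Summits.NavierStokesRegularity.NavierStokesRegularity.Theorems.QuarterLogPincerTypeIQuantSubcubicExpFrameTools
import Summits.NavierStokesRegularity.NavierStokesRegularity.Theorems.QuarterLogPincerQuietCoreDefs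
import Summits.NavierStokesRegularity.NavierStokesRegularity.Theorems.QuarterLogPincerQuietCoreBudgetPassSlice

/-!
# Route `QuarterLogPincer`, crux `TypeIQuantSubcubicExp` (stmt-NavierStokesRegularity-24077), line `quiet_core` §1b Part B
# (ns-idea-7 g10, PROVED in-file v1.1; ported VERBATIM): THE BUDGET PASS S4♭ `stub_budgetPass : StubBudgetPass` BY NAME

Calculus helpers, the per-slice estimate in physical time `norm_oseenSlice_le_of_subcritical`, and the budget pass
`budgetPass (M B) : BudgetPass M B` — the line's NEW lever (the log-cube budget replaces the energy in the far Duhamel part,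
time-integrably) — with the registered stub `stub_budgetPass : StubBudgetPass` closed BY NAME over the re-homed objects
(`…QuietCoreDefs.lean`).  Bodies are the line's (tree sha12 d1a96bf31391 (v1.5); independently certified rc 0 / std axioms by ns-afl-r1
g11, 2026-08-29T00:59Z).  HONEST FRAME: an estimate about HYPOTHETICAL Type-I ancient mild fields with a log-cube budget; nothing
here bears on 24077, W7 or Navier–Stokes regularity (OPEN).  Port by the pub-ns-dss typer (g36), DIRECTOR-NS KEY-NS #181/#182.
-/

noncomputable section

set_option linter.dupNamespace false

namespace Summit.NavierStokesRegularity.NavierStokesRegularity.Cruxes.TypeIQuantSubcubicExp.QuietCore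

open MeasureTheory Set Function Metric Filter Topology
open scoped ENNReal NNReal
open Literature.Analysis Literature.Analysis.FluidPDE
open Summit.NavierStokesRegularity.NavierStokesRegularity.Cruxes.TypeIQuantSubcubicExp.TruncationEdge

/-! ### §1b  Part B: calculus helpers, the per-slice estimate in physical time, and the budget pass `budgetPass` -/

/-- `∫_{(a,t)} (t−s)^{-3/4} ds = 4 (t−a)^{1/4}`. -/
theorem setIntegral_Ioo_sub_rpow_neg_three_quarters {a t : ℝ} (hat : a ≤ t) :
    ∫ s in Ioo a t, (t - s) ^ (-(3 / 4 : ℝ)) = 4 * (t - a) ^ (1 / 4 : ℝ) := by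
  rw [← integral_Ioc_eq_integral_Ioo, ← intervalIntegral.integral_of_le hat,
    intervalIntegral.integral_comp_sub_left (fun s : ℝ => s ^ (-(3 / 4 : ℝ))) t, sub_self,
    integral_rpow (Or.inl (by norm_num))]
  have h1 : (-(3 / 4 : ℝ)) + 1 = 1 / 4 := by norm_num
  rw [h1, Real.zero_rpow (by norm_num), sub_zero]
  ring

/-- `log(1/u) ≤ 2 u^{-1/2}` for `u > 0`. -/
theorem log_one_div_le_two_mul_rpow {u : ℝ} (hu : 0 < u) :
    Real.log (1 / u) ≤ 2 * u ^ (-(1 / 2 : ℝ)) := by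
  have hz : 0 < u ^ (-(1 / 2 : ℝ)) := Real.rpow_pos_of_pos hu _
  have h1 : Real.log (u ^ (-(1 / 2 : ℝ))) ≤ u ^ (-(1 / 2 : ℝ)) - 1 := Real.log_le_sub_one_of_pos hz
  rw [Real.log_rpow hu] at h1
  rw [one_div, Real.log_inv]
  linarith

/-- **The per-slice estimate in physical time.**  For a Type-I ancient mild field with cube budget `B`, a base time
`s ∈ [−1/2, 0)`, times `s < τ < t < 0`, the subcritical bound at time `τ` on `B(0,3/4)` and a core point `‖x‖ < 1/2`:
`‖N_{t−τ}[v(τ),v(τ)](x)‖ ≤ 16 C I c₀² (−s)^{-3/4} (t−τ)^{-3/4} + 1536 C B (t−τ)^{-1/2} + (256 C B + 625 C J₄ + 16·2^{7/2} C M² J₇)`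
(three regions: near by the hypothesis, middle by the budget at radius `(−τ)^{-2}`, far by the Type-I rate). -/
theorem norm_oseenSlice_le_of_subcritical {C : ℝ} (hC : 0 < C)
    (hK : ∀ {τ : ℝ}, 0 < τ → ∀ z a b : EuclideanSpace ℝ (Fin 3),
      ‖oseenKernel τ z a b‖ ≤ C * (τ + ‖z‖ ^ 2) ^
        (-(((Module.finrank ℝ (EuclideanSpace ℝ (Fin 3)) : ℝ) + 1) / 2)) * ‖a‖ * ‖b‖)
    {M B c₀ : ℝ} (hc₀ : 0 < c₀) {v : ℝ → EuclideanSpace ℝ (Fin 3) → EuclideanSpace ℝ (Fin 3)}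
    (hv : IsTypeIAncientMild M v) (hBud : CubeBudgetWith B v)
    {s τ t : ℝ} (hs : s ∈ Set.Ico (-(1 / 2 : ℝ)) 0) (hsτ : s < τ) (hτt : τ < t) (ht0 : t < 0)
    (hsubτ : ∀ y ∈ Metric.ball (0 : EuclideanSpace ℝ (Fin 3)) (3 / 4),
      ‖v τ y‖ ≤ 4 * c₀ * (-s) ^ (-(3 / 8 : ℝ)) * (-τ) ^ (-(1 / 8 : ℝ)))
    {x : EuclideanSpace ℝ (Fin 3)} (hx : ‖x‖ < 1 / 2) :
    ‖oseenSlice (t - τ) (v τ) (v τ) x‖ ≤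
      16 * C * (∫ w : EuclideanSpace ℝ (Fin 3), (1 + ‖w‖ ^ 2) ^
          (-(((Module.finrank ℝ (EuclideanSpace ℝ (Fin 3)) : ℝ) + 1) / 2))) * c₀ ^ 2 *
          (-s) ^ (-(3 / 4 : ℝ)) * (t - τ) ^ (-(3 / 4 : ℝ)) +
      1536 * C * B * (t - τ) ^ (-(1 / 2 : ℝ)) +
      (256 * C * B + 625 * C * jFour + 16 * (2 : ℝ) ^ (7 / 2 : ℝ) * C * M ^ 2 * jSeven) := by
  set I : ℝ := ∫ w : EuclideanSpace ℝ (Fin 3), (1 + ‖w‖ ^ 2) ^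
      (-(((Module.finrank ℝ (EuclideanSpace ℝ (Fin 3)) : ℝ) + 1) / 2)) with hI_def
  have hI0 : 0 ≤ I := integral_nonneg fun w => Real.rpow_nonneg (by positivity) _
  have hM0 : 0 ≤ M := hv.nonneg
  have hB0 : 0 ≤ B := hBud.1
  have hτ0 : τ < 0 := hτt.trans ht0
  have hu0 : 0 < -τ := by linarith
  have hσ : 0 < t - τ := by linarith
  have hσu : t - τ ≤ -τ := by linarith
  have hu1 : -τ ≤ 1 / 2 := by linarith [hs.1]
  have hu_le_one : -τ ≤ 1 := by linarith
  -- near bound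
  set Pτ : ℝ := (4 * c₀ * (-s) ^ (-(3 / 8 : ℝ)) * (-τ) ^ (-(1 / 8 : ℝ))) ^ 2 with hP
  have hnear : ∀ y, ‖y‖ < 3 / 4 → ‖v τ y‖ ^ 2 ≤ Pτ := fun y hy => by
    rw [hP]
    exact pow_le_pow_left₀ (norm_nonneg _) (hsubτ y (mem_ball_zero_iff.2 hy)) 2
  -- far sup bound
  have hfar : ∀ y, ‖v τ y‖ ≤ M / Real.sqrt (-τ) := fun y => hv.norm_le hτ0 y
  -- the radius `Rτ = (−τ)^{-2}` and the budget there with `ε = −τ`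
  set Rτ : ℝ := (-τ) ^ (-(2 : ℝ)) with hRτ
  have hRτ_eq : Rτ = 1 / (-τ) ^ 2 := by
    rw [hRτ, Real.rpow_neg hu0.le, show (2 : ℝ) = ((2 : ℕ) : ℝ) by norm_num, Real.rpow_natCast, one_div]
  have hRτ2 : 2 ≤ Rτ := by
    rw [hRτ_eq, le_div_iff₀ (by positivity)]
    nlinarith [hu1, hu0]
  have hRτ1 : 1 ≤ Rτ := by linarith
  obtain ⟨b, hb0, hb3, hbsl⟩ := hBud.2 Rτ hRτ2 (-τ) ⟨hu0, hu_le_one⟩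
  have hslice := hbsl τ ⟨by linarith [hs.1], by linarith⟩
  -- integrability of `‖v τ‖³` on the ball and the cube bound as a real integral
  have hcont : Continuous (v τ) := hv.continuous_slice hτ0
  have hint3 : IntegrableOn (fun y => ‖v τ y‖ ^ 3) (Metric.ball (0 : EuclideanSpace ℝ (Fin 3)) Rτ) := by
    have hc3 : Continuous fun y => ‖v τ y‖ ^ 3 := (hcont.norm).pow 3
    exact (hc3.continuousOn.integrableOn_compact (isCompact_closedBall 0 Rτ)).mono_set ball_subset_closedBall
  have hQ : ∫ y in Metric.ball (0 : EuclideanSpace ℝ (Fin 3)) Rτ, ‖v τ y‖ ^ 3 ≤ b ^ 3 := by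
    have hl := Summit.NavierStokesRegularity.NavierStokesRegularity.Theorems.ThinCascade.lintegral_cube_le_of_eLpNorm_three_le
      hslice hb0
    rw [integral_eq_lintegral_of_nonneg_ae (Eventually.of_forall fun y => by positivity)
      hint3.aestronglyMeasurable]
    refine ENNReal.toReal_le_of_le_ofReal (by positivity) ?_
    rw [← lintegral_indicator measurableSet_ball]
    refine le_of_eq_of_le (lintegral_congr fun y => ?_) hl
    by_cases hy : y ∈ Metric.ball (0 : EuclideanSpace ℝ (Fin 3)) Rτ
    · simp [Set.indicator_of_mem hy]
    · simp [Set.indicator_of_notMem hy]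
  -- the three-region lemma
  have hS := norm_oseenSlice_core hC hK hσ (P := Pτ) (Mf := M / Real.sqrt (-τ)) (Q := b ^ 3) (R := Rτ)
    (by positivity) (by positivity) hRτ1 hnear hfar hint3 hQ hx
  -- ### arithmetic: term 1 (near)
  have hP_eq : Pτ = 16 * c₀ ^ 2 * (-s) ^ (-(3 / 4 : ℝ)) * (-τ) ^ (-(1 / 4 : ℝ)) := by
    have hs0 : 0 ≤ -s := by linarith [hs.2]
    rw [hP, mul_pow, mul_pow, mul_pow, ← Real.rpow_mul_natCast hs0, ← Real.rpow_mul_natCast hu0.le]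
    norm_num
  have h1 : C * Pτ * I * (t - τ) ^ (-(1 / 2 : ℝ)) ≤
      16 * C * I * c₀ ^ 2 * (-s) ^ (-(3 / 4 : ℝ)) * (t - τ) ^ (-(3 / 4 : ℝ)) := by
    have hq : (-τ) ^ (-(1 / 4 : ℝ)) ≤ (t - τ) ^ (-(1 / 4 : ℝ)) :=
      Real.rpow_le_rpow_of_nonpos hσ hσu (by norm_num)
    have hsplit : (t - τ) ^ (-(3 / 4 : ℝ)) = (t - τ) ^ (-(1 / 4 : ℝ)) * (t - τ) ^ (-(1 / 2 : ℝ)) := by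
      rw [← Real.rpow_add hσ]; norm_num
    have hs34 : 0 ≤ (-s) ^ (-(3 / 4 : ℝ)) := Real.rpow_nonneg (by linarith [hs.2]) _
    have hh : 0 ≤ (t - τ) ^ (-(1 / 2 : ℝ)) := Real.rpow_nonneg hσ.le _
    rw [hP_eq, hsplit]
    have := mul_le_mul_of_nonneg_left hq (by positivity : 0 ≤ 16 * C * I * c₀ ^ 2 * (-s) ^ (-(3 / 4 : ℝ)) *
      (t - τ) ^ (-(1 / 2 : ℝ)))
    calc C * (16 * c₀ ^ 2 * (-s) ^ (-(3 / 4 : ℝ)) * (-τ) ^ (-(1 / 4 : ℝ))) * I * (t - τ) ^ (-(1 / 2 : ℝ))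
        = 16 * C * I * c₀ ^ 2 * (-s) ^ (-(3 / 4 : ℝ)) * (t - τ) ^ (-(1 / 2 : ℝ)) * (-τ) ^ (-(1 / 4 : ℝ)) := by
          ring
      _ ≤ 16 * C * I * c₀ ^ 2 * (-s) ^ (-(3 / 4 : ℝ)) * (t - τ) ^ (-(1 / 2 : ℝ)) * (t - τ) ^ (-(1 / 4 : ℝ)) :=
          this
      _ = 16 * C * I * c₀ ^ 2 * (-s) ^ (-(3 / 4 : ℝ)) * ((t - τ) ^ (-(1 / 4 : ℝ)) * (t - τ) ^ (-(1 / 2 : ℝ))) := by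
          ring
  -- ### term 2 (budget): `b³ ≤ B(1 + log Rτ + log(1/(−τ))) = B(1 + 3 log(1/(−τ))) ≤ B(1 + 6 (t−τ)^{-1/2})`
  have h2 : 256 * C * b ^ 3 ≤ 256 * C * B + 1536 * C * B * (t - τ) ^ (-(1 / 2 : ℝ)) := by
    have hlogR : Real.log Rτ = 2 * Real.log (1 / (-τ)) := by
      rw [hRτ, Real.log_rpow hu0, one_div, Real.log_inv]; ring
    have hlog : Real.log (1 / (-τ)) ≤ 2 * (t - τ) ^ (-(1 / 2 : ℝ)) := by
      refine (log_one_div_le_two_mul_rpow hu0).trans ?_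
      have : (-τ) ^ (-(1 / 2 : ℝ)) ≤ (t - τ) ^ (-(1 / 2 : ℝ)) :=
        Real.rpow_le_rpow_of_nonpos hσ hσu (by norm_num)
      linarith
    have hb3' : b ^ 3 ≤ B * (1 + 6 * (t - τ) ^ (-(1 / 2 : ℝ))) := by
      refine hb3.trans ?_
      rw [hlogR]
      exact mul_le_mul_of_nonneg_left (by linarith) hB0
    nlinarith [hb3', hC.le]
  -- ### term 4 (far): `(M/√(−τ))² Rτ^{-1/2} = M²`
  have h4 : 16 * (2 : ℝ) ^ (7 / 2 : ℝ) * C * (M / Real.sqrt (-τ)) ^ 2 * Rτ ^ (-(1 / 2 : ℝ)) * jSeven =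
      16 * (2 : ℝ) ^ (7 / 2 : ℝ) * C * M ^ 2 * jSeven := by
    have hR12 : Rτ ^ (-(1 / 2 : ℝ)) = -τ := by
      rw [hRτ, ← Real.rpow_mul hu0.le]; norm_num
    have hMM : (M / Real.sqrt (-τ)) ^ 2 * Rτ ^ (-(1 / 2 : ℝ)) = M ^ 2 := by
      rw [hR12, div_pow, Real.sq_sqrt hu0.le]
      exact div_mul_cancel₀ (M ^ 2) hu0.ne'
    calc 16 * (2 : ℝ) ^ (7 / 2 : ℝ) * C * (M / Real.sqrt (-τ)) ^ 2 * Rτ ^ (-(1 / 2 : ℝ)) * jSeven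
        = 16 * (2 : ℝ) ^ (7 / 2 : ℝ) * C * ((M / Real.sqrt (-τ)) ^ 2 * Rτ ^ (-(1 / 2 : ℝ))) * jSeven := by ring
      _ = 16 * (2 : ℝ) ^ (7 / 2 : ℝ) * C * M ^ 2 * jSeven := by rw [hMM]
  -- ### combine
  calc ‖oseenSlice (t - τ) (v τ) (v τ) x‖
      ≤ C * Pτ * I * (t - τ) ^ (-(1 / 2 : ℝ)) + 256 * C * b ^ 3 + 625 * C * jFour +
          16 * (2 : ℝ) ^ (7 / 2 : ℝ) * C * (M / Real.sqrt (-τ)) ^ 2 * Rτ ^ (-(1 / 2 : ℝ)) * jSeven := hS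
    _ ≤ 16 * C * I * c₀ ^ 2 * (-s) ^ (-(3 / 4 : ℝ)) * (t - τ) ^ (-(3 / 4 : ℝ)) +
          (256 * C * B + 1536 * C * B * (t - τ) ^ (-(1 / 2 : ℝ))) + 625 * C * jFour +
          16 * (2 : ℝ) ^ (7 / 2 : ℝ) * C * M ^ 2 * jSeven := by
        rw [← h4]; linarith [h1, h2]
    _ = _ := by ring

/-- **S4♭ PROVED: the budget pass.**  `s₂ = −1/2`; in the Oseen representation from time `s` the heat part is bounded
by the maximum principle (`M/√(−s)`), the Duhamel part by the time integral of `norm_oseenSlice_le_of_subcritical`: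
`64 C I c₀² (−s)^{-3/4}(t−s)^{1/4} + 3072 C B √(t−s) + a₃ (t−s) ≤ (64 C I c₀² + 3072 C B + a₃)/√(−s)`. -/
theorem budgetPass (M B : ℝ) : BudgetPass M B := by
  intro c₀ hc₀
  obtain ⟨C, hC, hK⟩ := exists_norm_oseenKernel_le (E := EuclideanSpace ℝ (Fin 3))
  set I : ℝ := ∫ w : EuclideanSpace ℝ (Fin 3), (1 + ‖w‖ ^ 2) ^
      (-(((Module.finrank ℝ (EuclideanSpace ℝ (Fin 3)) : ℝ) + 1) / 2)) with hI_def
  have hI0 : 0 ≤ I := integral_nonneg fun w => Real.rpow_nonneg (by positivity) _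
  have hJ4 := jFour_nonneg
  have hJ7 := jSeven_nonneg
  set a₃ : ℝ := 256 * C * |B| + 625 * C * jFour + 16 * (2 : ℝ) ^ (7 / 2 : ℝ) * C * M ^ 2 * jSeven with ha₃
  have ha₃0 : 0 ≤ a₃ := by rw [ha₃]; positivity
  set K : ℝ := |M| + 64 * C * I * c₀ ^ 2 + 3072 * C * |B| + a₃ with hK_def
  have hK0 : 0 ≤ K := by rw [hK_def]; positivity
  refine ⟨-(1 / 2), K, by norm_num, hK0, ?_⟩
  intro v hv hBud s hs hsub t ht x hx
  have hM0 : 0 ≤ M := hv.nonneg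
  have hB0 : 0 ≤ B := hBud.1
  have hMabs : |M| = M := abs_of_nonneg hM0
  have hBabs : |B| = B := abs_of_nonneg hB0
  have hs0 : 0 < -s := by linarith [hs.2]
  have hs1 : -s ≤ 1 / 2 := by linarith [hs.1]
  have hsq0 : 0 < Real.sqrt (-s) := Real.sqrt_pos.2 hs0
  have hsq1 : Real.sqrt (-s) ≤ 1 := by
    rw [← Real.sqrt_one]; exact Real.sqrt_le_sqrt (by linarith)
  have hxn : ‖x‖ < 1 / 2 := mem_ball_zero_iff.1 hx
  have hMK : M ≤ K := by
    rw [hK_def, hMabs]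
    have : 0 ≤ 64 * C * I * c₀ ^ 2 + 3072 * C * |B| + a₃ := by positivity
    linarith
  rcases eq_or_lt_of_le ht.1 with hts | hts
  · -- `t = s`: the Type-I rate itself
    rw [← hts]
    exact (hv.norm_le hs.2 x).trans (div_le_div_of_nonneg_right hMK hsq0.le)
  -- `s < t < 0`: the Oseen representation from time `s`
  have ht0 : t < 0 := ht.2
  have hT0 : 0 < t - s := by linarith
  have hTs : t - s ≤ -s := by linarith
  have hT1 : t - s ≤ 1 := by linarith
  have h1 := hv.2.2.1 s t hts ht0 x
  have h3 := oseenDuhamel_comp_sub_right 1 0 (t - s) (-s) v v x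
  simp only [sub_neg_eq_add, zero_add, sub_add_cancel] at h3
  -- heat part
  have hheat : ‖heatFlow (v s) (t - s) x‖ ≤ M / Real.sqrt (-s) := by
    rw [heatFlow_of_pos _ hT0]
    exact UnboundedOperators.norm_heatExtension_le (fun y => hv.norm_le hs.2 y) hT0 x
  -- Duhamel part: the majorant in shifted time `τ' ∈ (0, t − s)`
  set a₁ : ℝ := 16 * C * I * c₀ ^ 2 * (-s) ^ (-(3 / 4 : ℝ)) with ha₁
  set a₂ : ℝ := 1536 * C * B with ha₂
  set a₃' : ℝ := 256 * C * B + 625 * C * jFour + 16 * (2 : ℝ) ^ (7 / 2 : ℝ) * C * M ^ 2 * jSeven with ha₃'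
  have ha₃eq : a₃ = a₃' := by rw [ha₃, ha₃', hBabs]
  set m : ℝ → ℝ := fun τ' => a₁ * (t - s - τ') ^ (-(3 / 4 : ℝ)) + a₂ * (t - s - τ') ^ (-(1 / 2 : ℝ)) + a₃'
    with hm_def
  have hk34 : IntegrableOn (fun τ' : ℝ => (t - s - τ') ^ (-(3 / 4 : ℝ))) (Ioo 0 (t - s)) :=
    integrableOn_sub_rpow_Ioo (by norm_num)
  have hk12 : IntegrableOn (fun τ' : ℝ => (t - s - τ') ^ (-(1 / 2 : ℝ))) (Ioo 0 (t - s)) :=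
    integrableOn_sub_rpow_Ioo (by norm_num)
  have hkc : IntegrableOn (fun _ : ℝ => a₃') (Ioo 0 (t - s)) := integrableOn_const measure_Ioo_lt_top.ne
  have hmi : IntegrableOn m (Ioo 0 (t - s)) := ((hk34.const_mul a₁).add (hk12.const_mul a₂)).add hkc
  have hptw : ∀ᵐ τ' ∂(volume.restrict (Ioo 0 (t - s))),
      ‖oseenSlice (t - s - τ') (v (τ' + s)) (v (τ' + s)) x‖ ≤ m τ' := by
    filter_upwards [ae_restrict_mem measurableSet_Ioo] with τ' hτ'
    have hsτ : s < τ' + s := by linarith [hτ'.1]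
    have hτt : τ' + s < t := by linarith [hτ'.2]
    have hτ0 : τ' + s < 0 := hτt.trans ht0
    have hsl := norm_oseenSlice_le_of_subcritical hC hK hc₀ hv hBud hs hsτ hτt ht0
      (fun y hy => hsub (τ' + s) ⟨hsτ.le, hτ0⟩ y hy) hxn
    have hσeq : t - (τ' + s) = t - s - τ' := by ring
    rw [hσeq] at hsl
    rw [hm_def]
    simpa only [ha₁, ha₂, ha₃', hI_def] using hsl
  have hDuh : ‖oseenDuhamel 1 0 (fun τ => v (τ + s)) (fun τ => v (τ + s)) (t - s) x‖ ≤
      a₁ * (4 * (t - s) ^ (1 / 4 : ℝ)) + a₂ * (2 * (t - s) ^ (1 / 2 : ℝ)) + a₃' * (t - s) := by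
    rw [oseenDuhamel_one_eq_setIntegral_oseenSlice]
    refine (norm_integral_le_of_norm_le hmi hptw).trans (le_of_eq ?_)
    have e1 : ∫ τ' in Ioo 0 (t - s), (a₁ * (t - s - τ') ^ (-(3 / 4 : ℝ)) + a₂ * (t - s - τ') ^ (-(1 / 2 : ℝ)) + a₃') =
        (∫ τ' in Ioo 0 (t - s), (a₁ * (t - s - τ') ^ (-(3 / 4 : ℝ)) + a₂ * (t - s - τ') ^ (-(1 / 2 : ℝ)))) +
          ∫ _ in Ioo 0 (t - s), a₃' :=
      integral_add ((hk34.const_mul a₁).add (hk12.const_mul a₂)) hkc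
    have e2 : ∫ τ' in Ioo 0 (t - s), (a₁ * (t - s - τ') ^ (-(3 / 4 : ℝ)) + a₂ * (t - s - τ') ^ (-(1 / 2 : ℝ))) =
        (∫ τ' in Ioo 0 (t - s), a₁ * (t - s - τ') ^ (-(3 / 4 : ℝ))) +
          ∫ τ' in Ioo 0 (t - s), a₂ * (t - s - τ') ^ (-(1 / 2 : ℝ)) :=
      integral_add (hk34.const_mul a₁) (hk12.const_mul a₂)
    have e3 : ∫ τ' in Ioo 0 (t - s), a₁ * (t - s - τ') ^ (-(3 / 4 : ℝ)) = a₁ * (4 * (t - s) ^ (1 / 4 : ℝ)) := by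
      rw [integral_const_mul, setIntegral_Ioo_sub_rpow_neg_three_quarters hT0.le, sub_zero]
    have e4 : ∫ τ' in Ioo 0 (t - s), a₂ * (t - s - τ') ^ (-(1 / 2 : ℝ)) = a₂ * (2 * (t - s) ^ (1 / 2 : ℝ)) := by
      rw [integral_const_mul, setIntegral_Ioo_sub_rpow_neg_half hT0.le, sub_zero]
    have e5 : ∫ _ in Ioo 0 (t - s), a₃' = a₃' * (t - s) := by
      rw [setIntegral_const, smul_eq_mul, Real.volume_real_Ioo_of_le hT0.le, sub_zero, mul_comm]
    rw [hm_def]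
    show ∫ τ' in Ioo 0 (t - s), (a₁ * (t - s - τ') ^ (-(3 / 4 : ℝ)) + a₂ * (t - s - τ') ^ (-(1 / 2 : ℝ)) + a₃') = _
    rw [e1, e2, e3, e4, e5]
  -- ### final arithmetic
  have hq14 : (t - s) ^ (1 / 4 : ℝ) ≤ (-s) ^ (1 / 4 : ℝ) := Real.rpow_le_rpow hT0.le hTs (by norm_num)
  have hq12 : (t - s) ^ (1 / 2 : ℝ) ≤ 1 := Real.rpow_le_one hT0.le hT1 (by norm_num)
  have hsinv : (-s) ^ (-(3 / 4 : ℝ)) * (-s) ^ (1 / 4 : ℝ) = 1 / Real.sqrt (-s) := by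
    rw [← Real.rpow_add hs0, show (-(3 / 4 : ℝ)) + 1 / 4 = -(1 / 2 : ℝ) by norm_num, Real.rpow_neg hs0.le,
      Real.sqrt_eq_rpow, inv_eq_one_div]
  have hnear_fin : a₁ * (4 * (t - s) ^ (1 / 4 : ℝ)) ≤ 64 * C * I * c₀ ^ 2 / Real.sqrt (-s) := by
    have hs34 : 0 ≤ (-s) ^ (-(3 / 4 : ℝ)) := Real.rpow_nonneg hs0.le _
    calc a₁ * (4 * (t - s) ^ (1 / 4 : ℝ)) = 64 * C * I * c₀ ^ 2 * ((-s) ^ (-(3 / 4 : ℝ)) * (t - s) ^ (1 / 4 : ℝ)) := by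
          rw [ha₁]; ring
      _ ≤ 64 * C * I * c₀ ^ 2 * ((-s) ^ (-(3 / 4 : ℝ)) * (-s) ^ (1 / 4 : ℝ)) := by gcongr
      _ = 64 * C * I * c₀ ^ 2 / Real.sqrt (-s) := by rw [hsinv]; ring
  have hmid_fin : a₂ * (2 * (t - s) ^ (1 / 2 : ℝ)) ≤ 3072 * C * B / Real.sqrt (-s) := by
    have ha₂0 : 0 ≤ a₂ := by rw [ha₂]; positivity
    have h1' : a₂ * (2 * (t - s) ^ (1 / 2 : ℝ)) ≤ a₂ * 2 := by
      have := mul_le_mul_of_nonneg_left hq12 (by positivity : 0 ≤ 2 * a₂)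
      linarith
    have h2' : a₂ * 2 ≤ a₂ * 2 / Real.sqrt (-s) := by
      rw [le_div_iff₀ hsq0]; exact mul_le_of_le_one_right (by positivity) hsq1
    calc a₂ * (2 * (t - s) ^ (1 / 2 : ℝ)) ≤ a₂ * 2 / Real.sqrt (-s) := h1'.trans h2'
      _ = 3072 * C * B / Real.sqrt (-s) := by rw [ha₂]; ring
  have hconst_fin : a₃' * (t - s) ≤ a₃' / Real.sqrt (-s) := by
    have ha₃'0 : 0 ≤ a₃' := by rw [← ha₃eq]; exact ha₃0
    have h1' : a₃' * (t - s) ≤ a₃' := mul_le_of_le_one_right ha₃'0 hT1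
    have h2' : a₃' ≤ a₃' / Real.sqrt (-s) := by
      rw [le_div_iff₀ hsq0]; exact mul_le_of_le_one_right ha₃'0 hsq1
    exact h1'.trans h2'
  have hKeq : K / Real.sqrt (-s) = M / Real.sqrt (-s) + 64 * C * I * c₀ ^ 2 / Real.sqrt (-s) +
      3072 * C * B / Real.sqrt (-s) + a₃' / Real.sqrt (-s) := by
    rw [hK_def, hMabs, hBabs, ha₃eq]
    field_simp
  rw [h1, hKeq]
  calc ‖heatFlow (v s) (t - s) x - oseenDuhamel 1 s v v t x‖
      ≤ ‖heatFlow (v s) (t - s) x‖ + ‖oseenDuhamel 1 s v v t x‖ := norm_sub_le _ _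
    _ ≤ M / Real.sqrt (-s) + (a₁ * (4 * (t - s) ^ (1 / 4 : ℝ)) + a₂ * (2 * (t - s) ^ (1 / 2 : ℝ)) +
          a₃' * (t - s)) := by rw [← h3]; exact add_le_add hheat hDuh
    _ ≤ M / Real.sqrt (-s) + (64 * C * I * c₀ ^ 2 / Real.sqrt (-s) + 3072 * C * B / Real.sqrt (-s) +
          a₃' / Real.sqrt (-s)) := by linarith [hnear_fin, hmid_fin, hconst_fin]
    _ = _ := by ring


/-- Stub S4♭ — **PROVED in v1.1** (`budgetPass`; no `sorry`): kept under its registered name. -/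
theorem stub_budgetPass : StubBudgetPass := fun M B => budgetPass M B


end Summit.NavierStokesRegularity.NavierStokesRegularity.Cruxes.TypeIQuantSubcubicExp.QuietCore

end
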